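/-
Origin: expansion seat `planner-pub-hodgecm-toy-g2-0`, handover #25 2026-08-18T09:03:42Z (`HOME/pub-hodgecm-toy-g2/lean/ToyG2/RadicalBlock.lean`, md5 1e443bdb, 172 lines);
landed by the gen-7 packager in gate run 27 as `HodgeCM/Model/ToyG2/RadicalBlock.lean` (import ^import ToyG2\.→import HodgeCM.Model.ToyG2. ×1).
-/
/-
# HodgeCM.Model.ToyG2.RadicalBlock — `RadKilled` for maps from surfaces to a single period block (G1, block target)

Generation 2 of the `pub-hodgecm-toy` lineage (seat `planner-pub-hodgecm-toy-g2-0`), DESIGN.md §9 (G1), lemma L1.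

For the period surface `X = pbObj p` the left radical of the trace pairing in degrees (4, 0) is `ker ℓ`
(`HodgeRieszBlock`).  A morphism `f : S ⟶ pbObj p` from a surface (`dim S = 2`) is block-admissible, so its
`H¹`-pull-back is either `0` or `S.inclAt u' ∘ g` for a block leaf `u'` of `S` and a trace-preserving isomorphism `g`.
Lemma L1 (`trOf_comp_inclAt`): when `sdeg S = 4`, the degree-4 trace of `S` restricted along `⋀⁴ (S.inclAt u')` is a
rational multiple of the leaf trace `(S.leaf u').trace4` (shape induction; the other factor has degree 0).  Hence
`tr_S (⋀⁴ f^* y) = c · ℓ(y) = 0` for `y` in the radical: **`radKilled_pbObj_target`**.  Together with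
`RadicalFree` (block-free targets), h1 of `toyUniverse₃_modelAxioms_of'` now holds for block-free targets and for
the period surface itself; what remains of G1 is the case of targets that are products containing a block.
-/
import Mathlib
import Summits.HodgeConjecture.HodgeCM.Model.ToyG2.HodgeRieszBlock

namespace HodgeCM.ToyG2

open HodgeCM.Toy HodgeCM.Toy.CMPresentation
open Literature.AlgebraicGeometry.Motives
open scoped TensorProduct
open exteriorPower Obj₂

noncomputable section

/-! ### §1 A block leaf forces structural degree `≥ 4` -/

/-- (Ported verbatim from the HodgeCMPerL package; no docstring in the source.) -/
lemma four_le_sdeg_of_isPB : ∀ (s : Shape) (l : s.toType → Leaf) (u : s.toType),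
    (l u).IsPB → 4 ≤ sdeg s l := by
  intro s
  induction s with
  | empty => intro l u; exact u.elim
  | unit =>
    intro l u hu
    obtain ⟨⟩ := u
    show 4 ≤ 2 * (l ()).pdim
    cases hl : l () with
    | atom a => rw [hl] at hu; exact False.elim hu
    | pb p => rw [Leaf.pdim_pb]
  | sum a b iha ihb =>
    intro l u hu
    show 4 ≤ sdeg a (fun v => l (Sum.inl v)) + sdeg b (fun v => l (Sum.inr v))
    rcases u with u | u
    · exact (iha _ u hu).trans (Nat.le_add_right _ _)
    · exact (ihb _ u hu).trans (Nat.le_add_left _ _)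

/-! ### §2 One-sided families when the other factor has degree `0` -/

/-- (Ported verbatim from the HodgeCMPerL package; no docstring in the source.) -/
lemma trOf_prod_inl {X Y : Obj₂} (hX : sdeg X.s X.leaf = 4) (hY : sdeg Y.s Y.leaf = 0) :
    ∃ c : ℚ, trOf (X.prod Y) 4 ∘ₗ map 4 (X.toObj.inlL Y.toObj) = c • trOf X 4 := by
  refine ⟨trOf Y 0 (ιMulti ℚ 0 ![]), exteriorPower.linearMap_ext (AlternatingMap.ext fun x => ?_)⟩
  simp only [LinearMap.compAlternatingMap_apply, LinearMap.comp_apply, LinearMap.smul_apply,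
    map_apply_ιMulti, smul_eq_mul]
  have key := trOf_prod_append hX hY x ![]
  have hfam : Fin.append (fun i => X.toObj.inlL Y.toObj (x i)) (fun j => X.toObj.inrL Y.toObj (![] j))
      = ⇑(X.toObj.inlL Y.toObj) ∘ x := by
    rw [Fin.append_right_nil _ _ rfl]
    rfl
  rw [hfam] at key
  rw [mul_comm]
  exact key

/-- (Ported verbatim from the HodgeCMPerL package; no docstring in the source.) -/
lemma trOf_prod_inr {X Y : Obj₂} (hX : sdeg X.s X.leaf = 0) (hY : sdeg Y.s Y.leaf = 4) :
    ∃ c : ℚ, trOf (X.prod Y) 4 ∘ₗ map 4 (X.toObj.inrL Y.toObj) = c • trOf Y 4 := by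
  refine ⟨trOf X 0 (ιMulti ℚ 0 ![]), exteriorPower.linearMap_ext (AlternatingMap.ext fun y => ?_)⟩
  simp only [LinearMap.compAlternatingMap_apply, LinearMap.comp_apply, LinearMap.smul_apply,
    map_apply_ιMulti, smul_eq_mul]
  have key := trOf_prod_append hX hY ![] y
  have hfam : Fin.append (fun i => X.toObj.inlL Y.toObj (![] i)) (fun j => X.toObj.inrL Y.toObj (y j))
      = ⇑(X.toObj.inrL Y.toObj) ∘ y := by
    rw [Fin.append_left_nil _ _ rfl]
    rfl
  rw [hfam] at key
  exact key

/-! ### §3 Lemma L1: the trace of a degree-4 object along a block leaf -/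

/-- (Ported verbatim from the HodgeCMPerL package; no docstring in the source.) -/
theorem trOf_comp_incl : ∀ (s : Shape) (l : s.toType → Leaf) (u : s.toType),
    (l u).IsPB → sdeg s l = 4 →
    ∃ c : ℚ, trOf ⟨s, l⟩ 4 ∘ₗ map 4 (incl s l u) = c • (l u).trace4 := by
  intro s
  induction s with
  | empty => intro l u; exact u.elim
  | unit =>
    intro l u hu _h4
    obtain ⟨⟩ := u
    obtain ⟨p, hp⟩ : ∃ p, l () = Leaf.pb p := by
      cases hl : l () with
      | atom a => rw [hl] at hu; exact False.elim hu
      | pb p => exact ⟨p, rfl⟩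
    obtain rfl : l = fun _ => Leaf.pb p := funext fun v => by cases v; exact hp
    refine ⟨1, ?_⟩
    change trOf (pbObj p) 4 ∘ₗ map 4 LinearMap.id = (1 : ℚ) • p.ℓ
    rw [map_id, LinearMap.comp_id, one_smul, trOf_pbObj]
  | sum a b iha ihb =>
    intro l u hu h4
    obtain ⟨la, lb, rfl⟩ : ∃ la lb, l = Shape.sumElim la lb :=
      ⟨fun v => l (Sum.inl v), fun v => l (Sum.inr v), funext fun v => by rcases v with v | v <;> rfl⟩
    have h4' : sdeg a la + sdeg b lb = 4 := h4
    rcases u with u | u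
    · have ha : 4 ≤ sdeg a la := four_le_sdeg_of_isPB a la u hu
      have ha4 : sdeg a la = 4 := by omega
      have hb0 : sdeg b lb = 0 := by omega
      obtain ⟨c₁, hc₁⟩ := iha la u hu ha4
      obtain ⟨c₀, hc₀⟩ := trOf_prod_inl (X := ⟨a, la⟩) (Y := ⟨b, lb⟩) ha4 hb0
      refine ⟨c₀ * c₁, ?_⟩
      change trOf ((⟨a, la⟩ : Obj₂).prod ⟨b, lb⟩) 4 ∘ₗ
          map 4 ((⟨a, la⟩ : Obj₂).toObj.inlL (⟨b, lb⟩ : Obj₂).toObj ∘ₗ incl a la u)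
        = (c₀ * c₁) • (la u).trace4
      rw [map_comp, ← LinearMap.comp_assoc, hc₀, LinearMap.smul_comp, hc₁, smul_smul]
    · have hb : 4 ≤ sdeg b lb := four_le_sdeg_of_isPB b lb u hu
      have hb4 : sdeg b lb = 4 := by omega
      have ha0 : sdeg a la = 0 := by omega
      obtain ⟨c₁, hc₁⟩ := ihb lb u hu hb4
      obtain ⟨c₀, hc₀⟩ := trOf_prod_inr (X := ⟨a, la⟩) (Y := ⟨b, lb⟩) ha0 hb4
      refine ⟨c₀ * c₁, ?_⟩
      change trOf ((⟨a, la⟩ : Obj₂).prod ⟨b, lb⟩) 4 ∘ₗ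
          map 4 ((⟨a, la⟩ : Obj₂).toObj.inrL (⟨b, lb⟩ : Obj₂).toObj ∘ₗ incl b lb u)
        = (c₀ * c₁) • (lb u).trace4
      rw [map_comp, ← LinearMap.comp_assoc, hc₀, LinearMap.smul_comp, hc₁, smul_smul]

/-- **Lemma L1.** For an object of structural degree 4, the degree-4 trace restricted along a block leaf is a
rational multiple of that leaf's trace. -/
theorem trOf_comp_inclAt (S : Obj₂) (u : S.s.toType) (hu : (S.leaf u).IsPB) (h4 : sdeg S.s S.leaf = 4) :
    ∃ c : ℚ, trOf S 4 ∘ₗ map 4 (S.inclAt u) = c • (S.leaf u).trace4 := by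
  obtain ⟨s, l⟩ := S
  exact trOf_comp_incl s l u hu h4

/-! ### §4 G1 for the period surface as target -/

/-- `⋀⁴` of the zero map is zero -/
lemma extMap_four_zero (M N : Type*) [AddCommGroup M] [Module ℚ M] [AddCommGroup N] [Module ℚ N] :
    map 4 (0 : M →ₗ[ℚ] N) = 0 := by
  refine exteriorPower.linearMap_ext (AlternatingMap.ext fun v => ?_)
  rw [LinearMap.compAlternatingMap_apply, LinearMap.compAlternatingMap_apply, map_apply_ιMulti,
    LinearMap.zero_apply]
  exact (ιMulti ℚ 4).map_eq_zero_of_eq _ (i := (0 : Fin 4)) (j := (1 : Fin 4)) rfl (by decide)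

/-- the left radical of the period surface in degrees (4, 0) lies in `ker ℓ` -/
lemma ell_eq_zero_of_mem_leftRad {p : PLeaf} {y : ⋀[ℚ]^4 (pbObj p).L}
    (hy : y ∈ leftRad (pbObj p) 4 (2 * ((pbObj p).dim - 2))) : p.ℓ y = 0 := by
  have h := (mem_leftRad.1 hy) (one0 ℚ (pbObj p).L)
  change trOf (pbObj p) 4 (wedge ℚ (pbObj p).L 4 0 y (one0 ℚ (pbObj p).L)) = 0 at h
  rwa [wedge_one0, trOf_pbObj] at h

/-- **G1 for the period surface as target**: an admissible pull-back to a surface kills the radical `ker ℓ`. -/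
theorem radKilled_pbObj_target {S : Obj₂} {p : PLeaf} (hS : S.dim = 2) (f : Hom₂ S (pbObj p)) :
    RadKilled S (pbObj p) f := by
  intro y hy
  have hly : p.ℓ y = 0 := ell_eq_zero_of_mem_leftRad hy
  have h4 : sdeg S.s S.leaf = 4 := by rw [sdeg_eq, hS]
  show trOf S 4 (map 4 f.hom.lin y) = 0
  rcases f.adm () trivial with h0 | ⟨u', hu', g, hg, ht⟩
  · have hf : f.hom.lin = 0 := (LinearMap.comp_id _).symm.trans h0
    rw [hf, extMap_four_zero, LinearMap.zero_apply, map_zero]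
  · have hf : f.hom.lin = S.inclAt u' ∘ₗ g.toLinearMap := (LinearMap.comp_id _).symm.trans hg
    obtain ⟨c, hc⟩ := trOf_comp_inclAt S u' hu' h4
    have ht' : (S.leaf u').trace4 (map 4 g.toLinearMap y) = p.ℓ y := LinearMap.congr_fun ht y
    have hc' : trOf S 4 (map 4 (S.inclAt u') (map 4 g.toLinearMap y))
        = c * (S.leaf u').trace4 (map 4 g.toLinearMap y) := LinearMap.congr_fun hc _
    rw [hf, map_comp, LinearMap.comp_apply, hc', ht', hly, mul_zero]

/-- hence both hypotheses of `gysin_of_rad_riesz` hold for the period surface `pms` as target: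
`RadKilled` (this file) and `HodgeRiesz` (`hodgeRiesz_pbObj`) -/
theorem radKilled_and_hodgeRiesz_pbObj {p : PLeaf} (hp : (Leaf.pb p).Good) :
    (∀ (S : Obj₂) (f : Hom₂ S (pbObj p)), S.dim = 2 → RadKilled S (pbObj p) f) ∧ HodgeRiesz (pbObj p) :=
  ⟨fun _ f hS => radKilled_pbObj_target hS f, hodgeRiesz_pbObj hp⟩

end

end HodgeCM.ToyG2
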